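import Mathlib
import Literature.Combinatorics.Optimization.PatternMatrixPsdRank
import HarnessLib

/-!
# Semidefinite relaxations of Boolean Max-CSPs: low-degree sum-of-squares is optimal
# (Lee–Raghavendra–Steurer 2015, §1.2 and §6)

Third file of the tree's Lee–Raghavendra–Steurer story, after `CorrelationPolytopePsdRank.lean`
(Thm 1.1 = 5.4, `LeeRaghavendraSteurer2015_thm11`) and `PatternMatrixPsdRank.lean` (Thm 3.8 = 1.8,
`LeeRaghavendraSteurer2015_thm38`, with the cube vocabulary `cubeExpect`, `HasDegreeLE`,
`IsPseudoDensity`, `HasSosCertificate`, `patternMatrix`, `HasPsdFactorization` reused below).  This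
file TYPES §1.2 "Semidefinite relaxations and constraint satisfaction" and its technical
counterpart §6 "Optimality of low-degree sum-of-squares for max CSPs": the computational model
(subspace sum-of-squares upper bounds, `(c,s)`-approximation, the instance/solution matrix
`M^{n,Π}_{c,s}`) as real definitions, and the printed theorems as cited NAMED FACTS
(`def … : Prop`, not proved here; D-0014: no `sorry`, no axioms).

Source: J. R. Lee, P. Raghavendra, D. Steurer, *Lower bounds on the size of semidefinite programming
relaxations*, STOC 2015, 567–576 [LeeRaghavendraSteurer2015]; held text `paper:arxiv-1411.6317`
(arXiv TeX rendering; locators "Thm n (p. N)" are theorem numbers and pages of that rendering, the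
numbering the two sibling files use).  Typed for the pnp-psdrank cell (ladder FRONTIER rung F-N2,
consumer: the BARRIERS/NOVELTY context of crux `TracialDecayExp20`, stmt-PneNP-19878).

## Printed statements (verbatim up to notation) and how they are rendered

* §1.2 / §6.1 (p. 6 / p. 24), Max-CSPs: "For a finite collection `𝒫` of `k`-ary predicates
  `P : {0,1}^k → {0,1}`, we let Max-`𝒫` denote the following optimization problem: An instance `ℑ`
  consists of boolean variables `X_1,…,X_n` and a collection of `𝒫`-constraints
  `P_1(X)=1,…,P_M(X)=1` over these variables. A `𝒫`-constraint is a predicate `P_0 : {0,1}ⁿ → {0,1}`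
  such that `P_0(X) = P(X_{i_1},…,X_{i_k})` for some `P ∈ 𝒫` and DISTINCT indices `i_1,…,i_k ∈ [n]`.
  The objective is to find `x ∈ {0,1}ⁿ` … which maximizes `ℑ(x) = (1/M) Σ_{i=1}^M P_i(x)` …
  `opt(ℑ) = max_x ℑ(x)`. … Max Cut corresponds to the case where `𝒫` consists of the binary
  inequality predicate. For Max 3-Sat, `𝒫` contains all eight 3-literal disjunctions."
  — `CSPConstraint`, `CSPInstance`, `CSPInstance.val`, `CSPInstance.OptLE` (`opt(ℑ) ≤ s` as
  `∀ x, ℑ(x) ≤ s`), `maxCutPreds`, `maxThreeSatPreds`.  We require `M ≥ 1` ("`P_1,…,P_M`").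
  (NOT the tree's `Literature.Computability.Complexity.CSPConstraint`/`CSPInstance` of
  `GapCSP.lean` — same short names, different model: that is the general-alphabet MaxCSP of the
  PCP/gap-CSP side, constraints as variable lists with accepting-assignment lists and Boolean
  encodings for promise problems; LRS/KMR need Boolean `k`-ary predicates from a fixed family `𝒫`
  applied to DISTINCT indices, with the averaged objective `ℑ(x) ∈ [0,1]` as a real function on the
  cube, so the two vocabularies are kept apart deliberately.)
* Def. 1.4 (p. 5): "For a subspace `U` of real-valued functions on `{0,1}ⁿ`, the subspace-`U`
  sum-of-squares upper bound for `f`, denoted `sos_U(f)`, is the smallest number `c ∈ ℝ` such that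
  `c − f` is a sum of squares of functions from `U`, i.e., there exist `g_1,…,g_t ∈ U` such that
  `c − f = g_1² + ⋯ + g_t²` is an identity of functions on `{0,1}ⁿ`."  Def. 1.3 (p. 5): `sos_d(f)`,
  the same with "functions of degree at most `d/2`" (the tree's `HasSosCertificate d (c − f)`).
  eq. (2) (p. 6): "`U` achieves a `(c,s)`-approximation for `Π_n` if every instance `ℑ ∈ Π_n`
  satisfies `max(ℑ) ≤ s ⟹ sos_U(ℑ) ≤ c`."
  — RENDERING DECISION (recorded, not silent): `SubspaceSos U f c` below is "`c − f` is a sum of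
  squares of functions from `U`" (the certificate AT `c`), and `AchievesApprox 𝒫 U c s` is eq. (2)
  with `sos_U(ℑ) ≤ c` read as `SubspaceSos U ℑ c`.  For subspaces containing the constants (every
  degree-bounded space, every SDP relaxation in §6.1) the two readings coincide (`c − f = Σ gᵢ² +
  (√(c−c'))²`); for a general `U` the printed `sos_U(ℑ) ≤ c` ("smallest representable `c' ≤ c`")
  is formally weaker, so a typed conclusion "`U` fails to achieve" is implied by the printed one,
  and the typed reading is the one the printed proofs of Prop. 1.13 / Thm 6.2 / Thm 6.4 actually
  use ("this implies that `c − ℑ = Σᵢ gᵢ²` for `gᵢ ∈ U`", p. 9).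
* **Theorem 1.5** (p. 6, Max 3-Sat): "For every `s > 7/8`, there exists a constant `α > 0` such
  that for every `n ∈ ℕ` and every linear subspace `U` of functions `f : {0,1}ⁿ → ℝ` with
  `dim U ≤ n^{α log n / log log n}` there exists a Max 3-Sat instance `ℑ` on `n` variables such
  that `max(ℑ) ≤ s` but `sos_U(ℑ) = 1` (i.e., `U` fails to achieve a factor-`s` approximation for
  Max 3-Sat)."  — `LeeRaghavendraSteurer2015_thm15`.  Two recorded repairs: (i) "`sos_U(ℑ) = 1`" is
  typed through its parenthetical gloss, `U` certifies NO bound `c < 1` (`∀ c < 1, ¬ SubspaceSos U ℑ c`;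
  the value `1` itself is certified only when `1 − ℑ ∈ ΣU²`, which a small `U` need not provide);
  (ii) "for every `n ∈ ℕ`" is typed "for every `n ≥ n₀`" (`n₀ = n₀(s)`): for `n ≤ 2` there is no
  Max 3-Sat instance on `n` variables at all (three distinct indices), so the printed sentence is
  vacuously false there; `Ω`-style thresholds are the printed intent (proof via Thm 6.4/6.5, p. 26:
  "choose `n ≍ log N`").
* **Theorem 1.6** (p. 6, optimality of degree-`d` sos among SDP relaxations of size `n^{cd}`):
  "Let `Π` be a boolean CSP and let `Π_n` be the set of instances of `Π` on `n` variables. Suppose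
  that for some `m, d ∈ ℕ`, the subspace of degree-`d` functions `f : {0,1}^m → ℝ` fails to achieve a
  `(c,s)`-approximation for `Π_m` (in the sense of (2)). Then there exists a number
  `α = α(Π_m,c,s) > 0` such that for all `n ∈ ℕ`, every subspace `U` of functions `f : {0,1}ⁿ → ℝ`
  with `dim U ≤ α·(n/log n)^{d/4}` fails to achieve a `(c,s)`-approximation for `Π_n`."
  — `LeeRaghavendraSteurer2015_thm16`, with "for all `n`" typed "for all `n ≥ n₀`" for the same
  reason as (ii) above (`Π_n = ∅` for `n < k`).  "The subspace of degree-`d` functions" is the SET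
  `{g | HasDegreeLE d g}` (squares of degree-`d` functions, as printed; NB this is `sos_{2d}` in the
  convention of Def. 1.3 — we type what is printed, which is implied by what §6 proves).
* **Proposition 1.13** (p. 8): "For any boolean CSP `Π_n` and any constants `0 ≤ s < c ≤ 1`, let `U`
  be a subspace of minimal dimension that achieves a `(c,s)`-approximation for `Π_n`. Denote the
  set of instances `Π_n^{≤s} = {ℑ | max(ℑ) ≤ s}`. Let `M : Π_n^{≤s} × {0,1}ⁿ → ℝ` denote the matrix
  `M(ℑ,x) = c − ℑ(x)`. Then `rk_psd(M)² ≥ dim(U) ≥ rk_psd(M)`."  — `cspMatrix` (the matrix) and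
  `LeeRaghavendraSteurer2015_prop113` (both inequalities, in factorisation form: an achieving `U`
  gives a psd factorisation of size `dim U` (proof p. 8–9: `Q(x)_{ij} = q_i(x)q_j(x)` for a basis
  `q_i` of `U`, `M(ℑ,x) = Tr(Λ_ℑ Q(x))`); a psd factorisation of size `r` gives an achieving
  subspace of dimension `≤ r²`).
* §6.1 (p. 25): "`(c,s)`-approximations … we recall (from Prop. 1.13) the set of matrices
  `M^{n,Π}_{c,s}(ℑ,x) = c − ℑ(x)`, where the first index ranges over all instances on `n` variables
  satisfying `opt(ℑ) ≤ s`", and Prop. 6.1: "There exists a sequence of SDP relaxations `𝒮_n` of size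
  `r_n` achieving a `(c,s)`-approximation to Max-`Π_n` if and only if `rk_psd(M^{n,Π}_{c,s}) ≤ r_n`."
  By this printed identification, SDP-size lower bounds ARE psd-rank lower bounds for `cspMatrix`;
  Thm 6.4 is typed in that currency (its proof, p. 26, ends literally with "the same lower bound
  applies to `M^{N,Π}_{c,s}`").  The §6.1 linearization/spectrahedron model itself is not re-typed
  (the tree's `SDPFormulation` of Braun–Pokutta–Zink, `SymmetricSDPMatching.lean`, is the general
  framework containing it).
* **Theorem 6.4** (p. 25–26): "Fix a `k`-ary CSP Max-`Π` and a monotone increasing function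
  `d : ℕ → ℕ` such that … `d(1) ≥ 2⌈k/2⌉`, and `d(n) ≤ n` for all `n ≥ 1`, and
  `lim_{n→∞} d(n) = ∞`. Fix `ε > 0` and `0 < s < c ≤ 1`. There is a constant `K > 0` such that the
  following holds. Suppose that for every `n ≥ 1`, the degree-`d(n)` sos relaxation cannot achieve
  a `(c+ε,s)`-approximation for Max-`Π_n`. Then for all `n ≥ 1`, no SDP relaxation of size at most
  `K n^{d(n)²/8}` can achieve a `(c,s)`-approximation for Max-`Π_N` for every `N > n^{4d(n)}`."
  — `LeeRaghavendraSteurer2015_thm64`.  Recorded repair: the printed hypothesis "for EVERY `n ≥ 1`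
  the degree-`d(n)` relaxation fails on Max-`Π_n`" placed before the conclusion is unsatisfiable for
  `k ≥ 2` (`Π_1 = ∅`), which would make the sentence vacuous; the proof (p. 26: "Given that the
  degree-`d(n)` sos relaxation cannot achieve a `(c+ε,s)`-approximation for Max-`Π_n`, there exists
  an instance `ℑ` of Max-`Π_n` …") uses the hypothesis only at the SAME `n` as the conclusion, and
  the fact is typed in that pointwise form (`K` uniform in `n`, as printed).  "Degree-`d` sos
  relaxation achieves `(c,s)`" = `AchievesApprox` for the set of functions of degree `≤ d/2`
  (squares of degree `≤ d/2`, Def. 1.3 / eq. (sosrelaxation) p. 24; natural-number `d/2`).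
  **Third append (correction):** the two printed conditions "`d(1) ≥ 2⌈k/2⌉`" and "`d(n) ≤ n` for
  all `n ≥ 1`", typed verbatim in `LeeRaghavendraSteurer2015_thm64`, are jointly inconsistent for
  `k ≥ 1`, so that def is VACUOUS (discharged as such, `LeeRaghavendraSteurer2015_thm64_holds`, with
  the `k = 0` case `achievesApprox_of_arity_zero`); the contentful statement, with the two conditions
  as pointwise guards `2⌈k/2⌉ ≤ d(n) ≤ n` (how the proof p. 26 uses them), is the named fact
  `LeeRaghavendraSteurer2015_thm64_repaired` (NOT proved).
* **Theorem 6.5** (p. 26, "[Grigoriev2001, schoenebeck2008linear]"): "For every `ε > 0`, there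
  exists a constant `c_ε` such that the following holds. For every `n ≥ 1`, there is a Max 3-Sat`_n`
  instance `ℑ_n` such that `opt(ℑ_n) ≤ 7/8 + ε`, but `sos_{c_ε n}(ℑ) = 1`."  A theorem of
  G. Schoenebeck, *Linear level Lasserre lower bounds for certain k-CSPs*, FOCS 2008
  (doi:10.1109/focs.2008.74), restated by LRS; typed as `Schoenebeck2008_maxThreeSatSos` with
  "`n ≥ 1`" → "`n ≥ n₀`" (no instance exists for `n ≤ 2`) and "`= 1`" → "no degree-`⌊c_ε n⌋`
  certificate of any `c < 1`" (for `d ≥ 6` the bound `1` is always degree-`d` certified: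
  `1 − ℑ = (1/M) Σ_i (ℓ_{i1}ℓ_{i2}ℓ_{i3})²`, so this IS "`= 1`" there).

Not typed here: Cor. 1.2 (cut/TSP/stable-set polytopes) and §7 (nonnegative rank, superseded by
Kothari–Meka–Raghavendra 2017) — separate files of this directory; Thm 1.12 (Grigoriev's knapsack
degree bound) is PROVED in the tree in refutation currency
(`Literature.Computability.Complexity.Knapsack.not_hasSOSRefutation`).  The elementary API of the
model (`0 ≤ ℑ ≤ 1`, monotonicity of certificates in `U`, nonnegativity of `M^{n,Π}_{c,s}`) is
appended separately as proofs.
-/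

noncomputable section

open Finset Matrix
open scoped MatrixOrder

namespace Literature.Combinatorics.Optimization

/-! ### Boolean Max-CSPs (LRS §1.2 = §6.1) -/

/-- A **`𝒫`-constraint** (`𝒫` = the predicate collection `P` below) on the Boolean variables `X_1,…,X_n`: a predicate `P ∈ 𝒫` (`k`-ary)
applied to `k` DISTINCT variables, `P_0(X) = P(X_{i_1},…,X_{i_k})`.
[cite: LeeRaghavendraSteurer2015, §1.2 (p. 6) and §6.1 (p. 24)] -/
structure CSPConstraint (k n : ℕ) (P : Set ((Fin k → Bool) → Bool)) where
  /-- the predicate `P ∈ 𝒫` -/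
  pred : (Fin k → Bool) → Bool
  pred_mem : pred ∈ P
  /-- the distinct indices `i_1,…,i_k` -/
  idx : Fin k ↪ Fin n

namespace CSPConstraint

variable {k n : ℕ} {P : Set ((Fin k → Bool) → Bool)}

/-- `P_0(x) = P(x_{i_1},…,x_{i_k})`. [cite: LeeRaghavendraSteurer2015, §1.2 (p. 6)] -/
def sat (C : CSPConstraint k n P) (x : Fin n → Bool) : Bool := C.pred fun j => x (C.idx j)

end CSPConstraint

/-- An **instance of Max-`𝒫` on `n` variables**: constraints `P_1,…,P_M` (`M ≥ 1`).
[cite: LeeRaghavendraSteurer2015, §1.2 (p. 6) and §6.1 (p. 24)] -/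
structure CSPInstance (k n : ℕ) (P : Set ((Fin k → Bool) → Bool)) where
  /-- number of constraints -/
  M : ℕ
  M_pos : 0 < M
  /-- the constraints `P_1,…,P_M` -/
  cons : Fin M → CSPConstraint k n P

namespace CSPInstance

variable {k n : ℕ} {P : Set ((Fin k → Bool) → Bool)}

/-- The objective `ℑ(x) = (1/M) Σ_{i=1}^M P_i(x)` (fraction of satisfied constraints).
[cite: LeeRaghavendraSteurer2015, §1.2 (p. 6)] -/
def val (I : CSPInstance k n P) (x : Fin n → Bool) : ℝ :=
  (∑ i, if (I.cons i).sat x then (1 : ℝ) else 0) / I.M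

/-- "`opt(ℑ) ≤ s`" (`opt(ℑ) = max_{x ∈ {0,1}ⁿ} ℑ(x)`). [cite: LeeRaghavendraSteurer2015, §1.2 (p. 6)] -/
def OptLE (I : CSPInstance k n P) (s : ℝ) : Prop := ∀ x, I.val x ≤ s

end CSPInstance

/-- Max Cut: "`𝒫` consists of the binary inequality predicate". [cite: LeeRaghavendraSteurer2015, §1.2 (p. 6)] -/
def maxCutPreds : Set ((Fin 2 → Bool) → Bool) := {fun y => y 0 != y 1}

/-- Max 3-Sat: "`𝒫` contains all eight 3-literal disjunctions" — the disjunction with sign pattern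
`σ ∈ {0,1}³` is falsified exactly by the local assignment `σ`. [cite: LeeRaghavendraSteurer2015, §1.2 (p. 6)] -/
def maxThreeSatPreds : Set ((Fin 3 → Bool) → Bool) :=
  Set.range fun σ : Fin 3 → Bool => fun y => decide (y ≠ σ)

/-! ### Subspace sum-of-squares upper bounds and `(c,s)`-approximation (Def. 1.4, eq. (2)) -/

/-- **"`c − f` is a sum of squares of functions from `U`"**: `c − f = g_1² + ⋯ + g_t²` on `{0,1}ⁿ`
with all `g_i ∈ U` — the certificate behind "`sos_U(f) ≤ c`" (Def. 1.4; see the module docstring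
for the reading of `≤ c`).  For `U = {g | HasDegreeLE (d/2) g}` this is `HasSosCertificate d (c − f)`
(Def. 1.3, `sos_d(f) ≤ c`). [cite: LeeRaghavendraSteurer2015, Def. 1.4 (p. 5)] -/
def SubspaceSos {n : ℕ} (U : Set ((Fin n → Bool) → ℝ)) (f : (Fin n → Bool) → ℝ) (c : ℝ) : Prop :=
  ∃ (t : ℕ) (g : Fin t → (Fin n → Bool) → ℝ), (∀ i, g i ∈ U) ∧ ∀ x, c - f x = ∑ i, g i x ^ 2

/-- **`U` achieves a `(c,s)`-approximation for Max-`𝒫_n`**: every instance `ℑ` on `n` variables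
with `max(ℑ) ≤ s` has `sos_U(ℑ) ≤ c` (certificate at `c`). "Fails to achieve" is its negation.
[cite: LeeRaghavendraSteurer2015, eq. (2) (p. 6)] -/
def AchievesApprox {k n : ℕ} (P : Set ((Fin k → Bool) → Bool)) (U : Set ((Fin n → Bool) → ℝ))
    (c s : ℝ) : Prop :=
  ∀ I : CSPInstance k n P, I.OptLE s → SubspaceSos U I.val c

/-- The subspace of functions of (multilinear) degree at most `d` on `{0,1}ⁿ`, as a set ("the
subspace of degree-`d` functions"). [cite: LeeRaghavendraSteurer2015, Thm 1.6 (p. 6)] -/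
def degreeLE (n d : ℕ) : Set ((Fin n → Bool) → ℝ) := {g | HasDegreeLE d g}

/-! ### The instance/solution matrix `M^{n,Π}_{c,s}` (Prop. 1.13, §6.1) -/

/-- The instances of Max-`𝒫` on `n` variables with `opt(ℑ) ≤ s` — the row set `Π_n^{≤ s}`.
[cite: LeeRaghavendraSteurer2015, Prop. 1.13 (p. 8)] -/
def SoundInstances (k n : ℕ) (P : Set ((Fin k → Bool) → Bool)) (s : ℝ) : Type :=
  {I : CSPInstance k n P // I.OptLE s}

/-- **`M^{n,Π}_{c,s}(ℑ, x) = c − ℑ(x)`**, rows `ℑ ∈ Π_n^{≤ s}`, columns `x ∈ {0,1}ⁿ`.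
[cite: LeeRaghavendraSteurer2015, Prop. 1.13 (p. 8) and §6.1 (p. 25)] -/
def cspMatrix (k n : ℕ) (P : Set ((Fin k → Bool) → Bool)) (c s : ℝ) :
    SoundInstances k n P s → (Fin n → Bool) → ℝ :=
  fun I x => c - I.1.val x

/-- For the degree-bounded spaces the subspace certificate is the tree's `HasSosCertificate`:
`SubspaceSos (degreeLE n (d/2)) f c ↔ HasSosCertificate d (c − f)` (Def. 1.3 vs Def. 1.4).
[cite: LeeRaghavendraSteurer2015, Def. 1.3 and Def. 1.4 (p. 5)] -/
theorem subspaceSos_degreeLE_iff {n d : ℕ} (f : (Fin n → Bool) → ℝ) (c : ℝ) :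
    SubspaceSos (degreeLE n (d / 2)) f c ↔ HasSosCertificate d (fun x => c - f x) :=
  Iff.rfl

/-! ### The named facts -/

/-- **Lee–Raghavendra–Steurer 2015, Theorem 1.5 (Max 3-Sat has no polynomial-size SDP relaxation
beating `7/8`).** For every `s > 7/8` there are `α > 0` and `n₀` such that for every `n ≥ n₀` and
every linear subspace `U` of functions `{0,1}ⁿ → ℝ` with `dim U ≤ n^{α log n / log log n}` there is
a Max 3-Sat instance `ℑ` on `n` variables with `max(ℑ) ≤ s` for which `U` certifies no upper bound
`c < 1` (`c − ℑ ∉ ΣU²` for all `c < 1`; printed "`sos_U(ℑ) = 1` (i.e., `U` fails to achieve a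
factor-`s` approximation for Max 3-Sat)").  Printed "for every `n ∈ ℕ`"; the threshold `n₀` and the
reading of "`= 1`" are the recorded repairs of the module docstring.  NOT proved here (proof: Thm
6.4 + Thm 6.5 + Prop. 1.13, p. 26).
STATUS (2026-08-27, statement unchanged): the printed proof does NOT deliver this literal "`= 1`"
form (one instance killing every `c < 1`, with `n₀ = n₀(s)`).  Theorem 6.4 (p. 25) turns "degree-`d(n)`
sos cannot achieve a `(c + ε, s)`-approximation" into "no SDP relaxation of size `K n^{d(n)²/8}`
achieves a `(c, s)`-approximation" with `K = K(ε)` and `c + ε ≤ 1`, so Thm 6.5 (`sos_{c_ε n}(ℑ) = 1`)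
yields, for each `c < 1` separately, a threshold `n₀(s, c)` and an instance with `max ≤ s` on which `U`
certifies no value `≤ c` — that consequence is the tree THEOREM
`LeeRaghavendraSteurer2015_thm15_approx` (`MaxThreeSatThreeXorGapsUnconditional.lean`, unconditional,
via `LeeRaghavendraSteurer2015_thm38_holds` and `Schoenebeck2008_maxThreeSatSos_holds`), and it is
the reading of the parenthetical gloss as "for every `c < 1`, `U` fails to achieve a `(c,s)`-approximation
(eq. (2), p. 6) for Max 3-Sat once `n ≥ n₀(s,c)`".  Whether the literal
form below holds is not settled by [LeeRaghavendraSteurer2015]; consumers should use `_thm15_approx`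
(or `LeeRaghavendraSteurer2015_thm15.not_achievesApprox` for the implication from this fact).
[cite: LeeRaghavendraSteurer2015, Thm 1.5 (p. 6), Thm 6.4 (p. 25), Thm 6.5 (p. 26)] -/
def LeeRaghavendraSteurer2015_thm15 : Prop :=
  ∀ s : ℝ, 7 / 8 < s → ∃ α : ℝ, 0 < α ∧ ∃ n₀ : ℕ, ∀ n : ℕ, n₀ ≤ n →
    ∀ U : Submodule ℝ ((Fin n → Bool) → ℝ),
      (Module.finrank ℝ U : ℝ) ≤ (n : ℝ) ^ (α * Real.log n / Real.log (Real.log n)) →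
      ∃ I : CSPInstance 3 n maxThreeSatPreds, I.OptLE s ∧
        ∀ c : ℝ, c < 1 → ¬ SubspaceSos (U : Set ((Fin n → Bool) → ℝ)) I.val c

/-- **Lee–Raghavendra–Steurer 2015, Theorem 1.6 (degree-`d` sum-of-squares is optimal among SDP
relaxations of size `≍ (n/log n)^{d/4}` for every Boolean CSP).** Let `𝒫` be a finite set of
`k`-ary Boolean predicates and suppose that for some `m, d` the subspace of degree-`≤ d` functions
on `{0,1}^m` fails to achieve a `(c,s)`-approximation for Max-`𝒫_m`. Then there are
`α = α(𝒫, m, c, s) > 0` and `n₀` such that for all `n ≥ n₀` every subspace `U` of functions on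
`{0,1}ⁿ` with `dim U ≤ α (n / log n)^{d/4}` fails to achieve a `(c,s)`-approximation for Max-`𝒫_n`.
Printed "for all `n ∈ ℕ`" (vacuously false for `n < k`, where there are no instances); `log` is
`Real.log` (the base rescales `α`).  NOT proved here (proof: Thm 3.8 via Prop. 1.13, §6.2).
[cite: LeeRaghavendraSteurer2015, Thm 1.6 (p. 6)] -/
def LeeRaghavendraSteurer2015_thm16 : Prop :=
  ∀ (k : ℕ) (P : Set ((Fin k → Bool) → Bool)) (c s : ℝ) (m d : ℕ),
    ¬ AchievesApprox P (degreeLE m d) c s →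
    ∃ α : ℝ, 0 < α ∧ ∃ n₀ : ℕ, ∀ n : ℕ, n₀ ≤ n →
      ∀ U : Submodule ℝ ((Fin n → Bool) → ℝ),
        (Module.finrank ℝ U : ℝ) ≤ α * ((n : ℝ) / Real.log n) ^ ((d : ℝ) / 4) →
        ¬ AchievesApprox P (U : Set ((Fin n → Bool) → ℝ)) c s

/-- **Lee–Raghavendra–Steurer 2015, Proposition 1.13 (subspace dimension versus psd rank of
`M(ℑ,x) = c − ℑ(x)`).** For a Boolean CSP Max-`𝒫_n` and `0 ≤ s < c ≤ 1`:
(i) "`dim(U) ≥ rk_psd(M)`": every subspace `U` achieving a `(c,s)`-approximation for Max-`𝒫_n`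
yields a positive-semidefinite factorisation of `M^{n,Π}_{c,s}` of size `dim U` (p. 8–9: for a basis
`q_1,…,q_r` of `U` put `Q(x)_{ij} = q_i(x) q_j(x) ⪰ 0`; `c − ℑ = Σ g_i²`, `g_i ∈ U`, gives
`M(ℑ,x) = Tr(Λ_ℑ Q(x))` with `Λ_ℑ ⪰ 0`);
(ii) "`rk_psd(M)² ≥ dim(U)`" for `U` of minimal dimension: a psd factorisation of size `r` yields an
achieving subspace of dimension `≤ r²`.  PROVED at the end of this file
(`LeeRaghavendraSteurer2015_prop113_holds`). [cite: LeeRaghavendraSteurer2015, Prop. 1.13 (p. 8)] -/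
def LeeRaghavendraSteurer2015_prop113 : Prop :=
  ∀ (k n : ℕ) (P : Set ((Fin k → Bool) → Bool)) (c s : ℝ), 0 ≤ s → s < c → c ≤ 1 →
    (∀ U : Submodule ℝ ((Fin n → Bool) → ℝ),
        AchievesApprox P (U : Set ((Fin n → Bool) → ℝ)) c s →
        HasPsdFactorization (cspMatrix k n P c s) (Module.finrank ℝ U)) ∧
    (∀ r : ℕ, HasPsdFactorization (cspMatrix k n P c s) r →
        ∃ U : Submodule ℝ ((Fin n → Bool) → ℝ),
          AchievesApprox P (U : Set ((Fin n → Bool) → ℝ)) c s ∧ Module.finrank ℝ U ≤ r ^ 2)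

/-- **Lee–Raghavendra–Steurer 2015, Theorem 6.4 (quantitative version of Thm 1.6, growing
degree)**, in the psd-rank currency of Prop. 6.1 (`SDP relaxations of size r achieving (c,s) for
Max-Π_N ⟺ rk_psd(M^{N,Π}_{c,s}) ≤ r`, p. 25).  Fix `k`-ary predicates `𝒫`, a monotone
`d : ℕ → ℕ` with `d(1) ≥ 2⌈k/2⌉`, `d(n) ≤ n` (`n ≥ 1`) and `d(n) → ∞`, and `ε > 0`, `0 < s < c ≤ 1`.
Then there is `K > 0` such that for every `n ≥ 1`: if the degree-`d(n)` sos relaxation (squares of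
functions of degree `≤ d(n)/2`) fails to achieve a `(c+ε, s)`-approximation for Max-`𝒫_n`, then
for every `N > n^{4 d(n)}` the matrix `M^{N,Π}_{c,s}` has no psd factorisation of size
`r ≤ K n^{d(n)²/8}` ("no SDP relaxation of size at most `K n^{d(n)²/8}` can achieve a
`(c,s)`-approximation for Max-`Π_N`").  The hypothesis is used at the same `n` as the conclusion
(printed with "for every `n ≥ 1`" in front, see the module docstring).  NOT proved here (proof:
Fact 6.3 `‖D‖_∞ ≤ 1 + n^{d(n)}` + Thm 3.8, p. 26). [cite: LeeRaghavendraSteurer2015, Thm 6.4 (p. 25–26)] -/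
def LeeRaghavendraSteurer2015_thm64 : Prop :=
  ∀ (k : ℕ) (P : Set ((Fin k → Bool) → Bool)) (d : ℕ → ℕ), Monotone d →
    2 * ((k + 1) / 2) ≤ d 1 → (∀ n, 1 ≤ n → d n ≤ n) → Filter.Tendsto d Filter.atTop Filter.atTop →
    ∀ (ε s c : ℝ), 0 < ε → 0 < s → s < c → c ≤ 1 →
    ∃ K : ℝ, 0 < K ∧ ∀ n : ℕ, 1 ≤ n →
      ¬ AchievesApprox P (degreeLE n (d n / 2)) (c + ε) s →
      ∀ N : ℕ, (n : ℝ) ^ (4 * d n) < N →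
      ∀ r : ℕ, (r : ℝ) ≤ K * (n : ℝ) ^ ((d n : ℝ) ^ 2 / 8) →
        ¬ HasPsdFactorization (cspMatrix k N P c s) r

/-- **Schoenebeck 2008 (as restated in Lee–Raghavendra–Steurer 2015, Theorem 6.5): linear-degree
sum-of-squares does not beat `7/8` on Max 3-Sat.** For every `ε > 0` there are `c_ε > 0` and `n₀`
such that for every `n ≥ n₀` some Max 3-Sat instance `ℑ_n` on `n` variables has
`opt(ℑ_n) ≤ 7/8 + ε` while no bound `c < 1` has a degree-`⌊c_ε n⌋` sum-of-squares certificate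
(`c − ℑ_n ≠ Σ g_i²` with `deg g_i ≤ ⌊c_ε n⌋/2`; printed "`sos_{c_ε n}(ℑ) = 1`", and for degree
`≥ 6` the value `1` is always certified, `1 − ℑ = (1/M) Σ_i (ℓ_{i1}ℓ_{i2}ℓ_{i3})²`).  Printed "for
every `n ≥ 1`" (no instance exists for `n ≤ 2`).  NOT proved here; the proving source is
G. Schoenebeck, *Linear level Lasserre lower bounds for certain k-CSPs*, FOCS 2008
(doi:10.1109/focs.2008.74), after Grigoriev's 3-XOR bound [Grigoriev2001TCS].
[cite: LeeRaghavendraSteurer2015, Thm 6.5 (p. 26)] -/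
def Schoenebeck2008_maxThreeSatSos : Prop :=
  ∀ ε : ℝ, 0 < ε → ∃ cε : ℝ, 0 < cε ∧ ∃ n₀ : ℕ, ∀ n : ℕ, n₀ ≤ n →
    ∃ I : CSPInstance 3 n maxThreeSatPreds, I.OptLE (7 / 8 + ε) ∧
      ∀ c : ℝ, c < 1 → ¬ HasSosCertificate ⌊cε * n⌋₊ (fun x => c - I.val x)

/-! ### Elementary API of the model (appended; proofs only) -/

namespace CSPInstance

variable {k n : ℕ} {P : Set ((Fin k → Bool) → Bool)}

/-- `0 ≤ ℑ(x)`. [cite: LeeRaghavendraSteurer2015, §1.2 (p. 6)] -/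
theorem val_nonneg (I : CSPInstance k n P) (x : Fin n → Bool) : 0 ≤ I.val x :=
  div_nonneg (sum_nonneg fun i _ => by split_ifs <;> norm_num) (Nat.cast_nonneg _)

/-- `ℑ(x) ≤ 1`. [cite: LeeRaghavendraSteurer2015, §1.2 (p. 6)] -/
theorem val_le_one (I : CSPInstance k n P) (x : Fin n → Bool) : I.val x ≤ 1 := by
  have hM : (0 : ℝ) < I.M := by exact_mod_cast I.M_pos
  rw [val, div_le_one hM]
  calc ∑ i, (if (I.cons i).sat x then (1 : ℝ) else 0) ≤ ∑ _i : Fin I.M, (1 : ℝ) :=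
        sum_le_sum fun i _ => by split_ifs <;> norm_num
    _ = I.M := by simp

/-- Every instance satisfies `opt(ℑ) ≤ 1`. [cite: LeeRaghavendraSteurer2015, §1.2 (p. 6)] -/
theorem optLE_one (I : CSPInstance k n P) : I.OptLE 1 := fun x => I.val_le_one x

/-- `opt(ℑ) ≤ s` is monotone in `s`. [cite: LeeRaghavendraSteurer2015, §1.2 (p. 6)] -/
theorem OptLE.mono {I : CSPInstance k n P} {s s' : ℝ} (h : I.OptLE s) (hss' : s ≤ s') :
    I.OptLE s' := fun x => (h x).trans hss'

end CSPInstance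

/-- Entries of `M^{n,Π}_{c,s}` are nonnegative when `s ≤ c` (it is a "nonnegative matrix" in the
sense of Def. 1.7). [cite: LeeRaghavendraSteurer2015, §6.1 (p. 25)] -/
theorem cspMatrix_nonneg {k n : ℕ} {P : Set ((Fin k → Bool) → Bool)} {c s : ℝ} (hsc : s ≤ c)
    (I : SoundInstances k n P s) (x : Fin n → Bool) : 0 ≤ cspMatrix k n P c s I x := by
  have := I.2 x
  unfold cspMatrix
  linarith

/-- A sum-of-squares certificate at `c` bounds the objective: `f ≤ c` on the cube ("every function
`f` satisfies `sos_d(f) ≥ max(f)` since sums of squares of real-valued functions are nonnegative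
pointwise"). [cite: LeeRaghavendraSteurer2015, §1.2 (p. 5)] -/
theorem SubspaceSos.le {n : ℕ} {U : Set ((Fin n → Bool) → ℝ)} {f : (Fin n → Bool) → ℝ} {c : ℝ}
    (h : SubspaceSos U f c) (x : Fin n → Bool) : f x ≤ c := by
  obtain ⟨t, g, -, hfx⟩ := h
  have : 0 ≤ ∑ i, g i x ^ 2 := sum_nonneg fun i _ => sq_nonneg _
  linarith [hfx x]

/-- Monotonicity in the subspace: a larger set of admissible functions certifies at least as much.
[cite: LeeRaghavendraSteurer2015, Def. 1.4 (p. 5)] -/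
theorem SubspaceSos.mono {n : ℕ} {U V : Set ((Fin n → Bool) → ℝ)} (hUV : U ⊆ V)
    {f : (Fin n → Bool) → ℝ} {c : ℝ} (h : SubspaceSos U f c) : SubspaceSos V f c := by
  obtain ⟨t, g, hg, hfx⟩ := h
  exact ⟨t, g, fun i => hUV (hg i), hfx⟩

/-- If `U` contains the constant functions, certificates are upward closed in `c`:
`c − f = Σ gᵢ² ⟹ c' − f = Σ gᵢ² + (√(c'−c))²` for `c ≤ c'` — the case in which the printed
"`sos_U(f) ≤ c`" and the certificate-at-`c` reading coincide. [cite: LeeRaghavendraSteurer2015, Def. 1.4 (p. 5)] -/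
theorem SubspaceSos.of_le {n : ℕ} {U : Set ((Fin n → Bool) → ℝ)}
    (hU : ∀ a : ℝ, (fun _ : Fin n → Bool => a) ∈ U) {f : (Fin n → Bool) → ℝ} {c c' : ℝ}
    (h : SubspaceSos U f c) (hcc' : c ≤ c') : SubspaceSos U f c' := by
  obtain ⟨t, g, hg, hfx⟩ := h
  refine ⟨t + 1, Fin.snoc g fun _ => Real.sqrt (c' - c), fun i => ?_, fun x => ?_⟩
  · refine Fin.lastCases ?_ (fun j => ?_) i
    · simpa using hU (Real.sqrt (c' - c))
    · simpa using hg j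
  · rw [Fin.sum_univ_castSucc]
    simp only [Fin.snoc_castSucc, Fin.snoc_last]
    rw [← hfx x, Real.sq_sqrt (sub_nonneg.mpr hcc')]
    ring

/-- Monotonicity of `(c,s)`-approximation in the subspace. [cite: LeeRaghavendraSteurer2015, eq. (2) (p. 6)] -/
theorem AchievesApprox.mono {k n : ℕ} {P : Set ((Fin k → Bool) → Bool)}
    {U V : Set ((Fin n → Bool) → ℝ)} (hUV : U ⊆ V) {c s : ℝ} (h : AchievesApprox P U c s) :
    AchievesApprox P V c s :=
  fun I hI => (h I hI).mono hUV

/-- A `(c,s)`-approximation is also a `(c,s')`-approximation for `s' ≤ s` (fewer instances to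
certify). [cite: LeeRaghavendraSteurer2015, eq. (2) (p. 6)] -/
theorem AchievesApprox.anti {k n : ℕ} {P : Set ((Fin k → Bool) → Bool)}
    {U : Set ((Fin n → Bool) → ℝ)} {c s s' : ℝ} (h : AchievesApprox P U c s) (hs : s' ≤ s) :
    AchievesApprox P U c s' :=
  fun I hI => h I (hI.mono hs)

/-! ### Proposition 1.13, PROVED (appended): `rk_psd(M)² ≥ dim(U) ≥ rk_psd(M)` -/

/-- `Tr(vecMulVec a a * vecMulVec q q) = (a ⬝ᵥ q)²`. [folklore] -/
private theorem trace_vecMulVec_mul_vecMulVec {r : ℕ} (a q : Fin r → ℝ) :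
    (vecMulVec a a * vecMulVec q q).trace = (a ⬝ᵥ q) ^ 2 := by
  rw [vecMulVec_mul_vecMulVec, trace_vecMulVec, dotProduct_smul, smul_eq_mul, sq]

/-- **LRS Prop. 1.13, first inequality `dim(U) ≥ rk_psd(M)`** (proof p. 8–9): a subspace `U`
achieving a `(c,s)`-approximation gives a psd factorisation of `M^{n,Π}_{c,s}` of size `dim U`:
`Q(x) = q(x) q(x)ᵀ` for the coordinate vector `q(x)` of point evaluation in a basis of `U`, and
`Λ_ℑ = Σ_i λ_i λ_iᵀ` for the coordinates `λ_i` of the certificate `c − ℑ = Σ_i g_i²`.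
[cite: LeeRaghavendraSteurer2015, Prop. 1.13 (p. 8–9)] -/
theorem AchievesApprox.hasPsdFactorization {k n : ℕ} {P : Set ((Fin k → Bool) → Bool)} {c s : ℝ}
    (U : Submodule ℝ ((Fin n → Bool) → ℝ))
    (hU : AchievesApprox P (U : Set ((Fin n → Bool) → ℝ)) c s) :
    HasPsdFactorization (cspMatrix k n P c s) (Module.finrank ℝ U) := by
  classical
  set r := Module.finrank ℝ U
  let bU : Module.Basis (Fin r) ℝ U := Module.finBasis ℝ U
  -- point evaluations in coordinates
  let q : (Fin n → Bool) → Fin r → ℝ := fun x l => (bU l : (Fin n → Bool) → ℝ) x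
  -- certificates for the sound instances
  choose t g hg hfx using fun I : SoundInstances k n P s => hU I.1 I.2
  -- coordinates of the certificate functions
  let lam : (I : SoundInstances k n P s) → Fin (t I) → Fin r → ℝ :=
    fun I i => bU.repr ⟨g I i, hg I i⟩
  have hg_eq : ∀ (I : SoundInstances k n P s) (i : Fin (t I)) (x : Fin n → Bool),
      g I i x = lam I i ⬝ᵥ q x := by
    intro I i x
    have hsum := bU.sum_repr ⟨g I i, hg I i⟩
    have := congrArg (fun u : U => (u : (Fin n → Bool) → ℝ) x) hsum
    simp only [Submodule.coe_sum, Submodule.coe_smul, Finset.sum_apply, Pi.smul_apply,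
      smul_eq_mul] at this
    rw [← this, dotProduct]
  refine ⟨fun I => ∑ i, vecMulVec (lam I i) (lam I i), fun x => vecMulVec (q x) (q x),
    fun I => ?_, fun x => ?_, fun I x => ?_⟩
  · exact posSemidef_sum _ fun i _ => by
      simpa using posSemidef_vecMulVec_self_star (lam I i)
  · simpa using posSemidef_vecMulVec_self_star (q x)
  · rw [Finset.sum_mul, trace_sum]
    simp_rw [trace_vecMulVec_mul_vecMulVec, ← hg_eq]
    exact hfx I x

/-- `Σ_{a,b} (N a b)² = Tr(Nᵀ N)`. [folklore] -/
private theorem sum_sq_eq_trace_transpose_mul {r : ℕ} (N : Matrix (Fin r) (Fin r) ℝ) :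
    ∑ a, ∑ b, N a b ^ 2 = (Nᵀ * N).trace := by
  simp only [trace, diag_apply, mul_apply, transpose_apply, sq]
  exact Finset.sum_comm

/-- **LRS Prop. 1.13, second inequality `rk_psd(M)² ≥ dim(U)`**: a psd factorisation
`M(ℑ,x) = Tr(A_ℑ B_x)` of size `r` gives an achieving subspace of dimension `≤ r²`, namely the span
of the entries of `x ↦ B_x^{1/2}`: `c − ℑ(x) = ‖B_x^{1/2} A_ℑ^{1/2}‖_F² = Σ_{a,b} (B_x^{1/2} A_ℑ^{1/2})_{ab}²`.
[cite: LeeRaghavendraSteurer2015, Prop. 1.13 (p. 8–9)] -/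
theorem HasPsdFactorization.exists_achievesApprox {k n r : ℕ} {P : Set ((Fin k → Bool) → Bool)}
    {c s : ℝ} (h : HasPsdFactorization (cspMatrix k n P c s) r) :
    ∃ U : Submodule ℝ ((Fin n → Bool) → ℝ),
      AchievesApprox P (U : Set ((Fin n → Bool) → ℝ)) c s ∧ Module.finrank ℝ U ≤ r ^ 2 := by
  classical
  obtain ⟨A, B, hA, hB, hM⟩ := h
  -- square roots
  let S : (Fin n → Bool) → Matrix (Fin r) (Fin r) ℝ := fun x => CFC.sqrt (B x)
  let T : SoundInstances k n P s → Matrix (Fin r) (Fin r) ℝ := fun I => CFC.sqrt (A I)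
  have hSpsd : ∀ x, (S x).PosSemidef := fun x => (CFC.sqrt_nonneg (B x)).posSemidef
  have hTpsd : ∀ I, (T I).PosSemidef := fun I => (CFC.sqrt_nonneg (A I)).posSemidef
  have hSS : ∀ x, S x * S x = B x := fun x => CFC.sqrt_mul_sqrt_self (B x) (hB x).nonneg
  have hTT : ∀ I, T I * T I = A I := fun I => CFC.sqrt_mul_sqrt_self (A I) (hA I).nonneg
  have hSt : ∀ x, (S x)ᵀ = S x := fun x => by
    rw [← conjTranspose_eq_transpose_of_trivial]; exact (hSpsd x).1
  have hTt : ∀ I, (T I)ᵀ = T I := fun I => by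
    rw [← conjTranspose_eq_transpose_of_trivial]; exact (hTpsd I).1
  -- the subspace: span of the entry functions of `S`
  let e : Fin r × Fin r → (Fin n → Bool) → ℝ := fun al x => S x al.1 al.2
  let U : Submodule ℝ ((Fin n → Bool) → ℝ) := Submodule.span ℝ (Set.range e)
  refine ⟨U, fun I hI => ?_, ?_⟩
  · -- certificate: the entries of `S x * T I`
    let J : SoundInstances k n P s := ⟨I, hI⟩
    let gf : Fin r × Fin r → (Fin n → Bool) → ℝ := fun ab x => (S x * T J) ab.1 ab.2
    refine ⟨r * r, fun m => gf (finProdFinEquiv.symm m), fun m => ?_, fun x => ?_⟩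
    · -- membership in the span
      have : gf (finProdFinEquiv.symm m) =
          ∑ l, T J l (finProdFinEquiv.symm m).2 • e ((finProdFinEquiv.symm m).1, l) := by
        funext x
        simp only [gf, e, mul_apply, Finset.sum_apply, Pi.smul_apply, smul_eq_mul]
        exact Finset.sum_congr rfl fun l _ => mul_comm _ _
      change gf (finProdFinEquiv.symm m) ∈ U
      rw [this]
      exact Submodule.sum_mem _ fun l _ =>
        Submodule.smul_mem _ _ (Submodule.subset_span ⟨_, rfl⟩)
    · -- the sum-of-squares identity
      have hsum : ∑ m : Fin (r * r), gf (finProdFinEquiv.symm m) x ^ 2 =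
          ∑ a, ∑ b, (S x * T J) a b ^ 2 := by
        rw [← Fintype.sum_prod_type']
        exact Fintype.sum_equiv finProdFinEquiv.symm _ _ fun m => rfl
      rw [hsum, sum_sq_eq_trace_transpose_mul, transpose_mul, hSt, hTt]
      have : (T J * S x * (S x * T J)).trace = (A J * B x).trace := by
        rw [Matrix.mul_assoc, ← Matrix.mul_assoc (S x), hSS, trace_mul_comm, Matrix.mul_assoc,
          hTT, trace_mul_comm]
      rw [this, ← hM]
      rfl
  · calc Module.finrank ℝ U ≤ Fintype.card (Fin r × Fin r) := finrank_range_le_card e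
      _ = r ^ 2 := by simp [sq]

/-- **Discharge of `LeeRaghavendraSteurer2015_prop113`** (both inequalities, from the two theorems
above; the side conditions `0 ≤ s < c ≤ 1` are not needed). [cite: LeeRaghavendraSteurer2015, Prop. 1.13 (p. 8–9)] -/
theorem LeeRaghavendraSteurer2015_prop113_holds : LeeRaghavendraSteurer2015_prop113 :=
  fun _k _n _P _c _s _ _ _ =>
    ⟨fun U hU => AchievesApprox.hasPsdFactorization U hU,
     fun _r h => h.exists_achievesApprox⟩

/-! ### Planting an `m`-variable instance on an `m`-subset of `[n]` (LRS §6.2: "`M_n^f` is a submatrix of `M^{n,Π}_{c,s}`") -/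

namespace CSPInstance

variable {k m n : ℕ} {P : Set ((Fin k → Bool) → Bool)}

/-- **Planting**: the instance `ℑ_S` on `n` variables obtained from an instance `ℑ` on `m` variables
by renaming its variables along an embedding `e : [m] ↪ [n]` (in print: along the increasing
enumeration of an `m`-subset `S ⊆ [n]`), so that `ℑ_S(x) = ℑ(x_S)`.
[cite: LeeRaghavendraSteurer2015, §6.2 (p. 25–26: proof of Thm 6.2, "Since M_n^f is a submatrix of M^{n,Π}_{c,s}")] -/
def plant (I : CSPInstance k m P) (e : Fin m ↪ Fin n) : CSPInstance k n P where
  M := I.M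
  M_pos := I.M_pos
  cons i := ⟨(I.cons i).pred, (I.cons i).pred_mem, (I.cons i).idx.trans e⟩

/-- `ℑ_S(x) = ℑ(x ∘ e)`. [cite: LeeRaghavendraSteurer2015, §6.2 (p. 25–26)] -/
theorem plant_val (I : CSPInstance k m P) (e : Fin m ↪ Fin n) (x : Fin n → Bool) :
    (I.plant e).val x = I.val (x ∘ e) := rfl

/-- Planting preserves `opt ≤ s`. [cite: LeeRaghavendraSteurer2015, §6.2 (p. 25–26)] -/
theorem OptLE.plant {I : CSPInstance k m P} {s : ℝ} (h : I.OptLE s) (e : Fin m ↪ Fin n) :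
    (I.plant e).OptLE s := fun x => by
  rw [plant_val]; exact h _

end CSPInstance

/-- **The pattern matrix of `f = c − ℑ` is a submatrix of `M^{n,Π}_{c,s}`** (LRS §6.2): for an
instance `ℑ` of Max-`𝒫_m` with `opt(ℑ) ≤ s`, row `S` (`|S| = m`) of `M_n^f`, `f(y) = c − ℑ(y)`, is the
row of the planted instance `ℑ_S`; hence a psd factorisation of `M^{n,Π}_{c,s}` of size `r` restricts
to one of `M_n^f`. [cite: LeeRaghavendraSteurer2015, Thm 6.2 proof (p. 25–26)] -/
theorem HasPsdFactorization.patternMatrix_of_cspMatrix {k m n r : ℕ}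
    {P : Set ((Fin k → Bool) → Bool)} {c s : ℝ} (I : CSPInstance k m P) (hI : I.OptLE s)
    (h : HasPsdFactorization (cspMatrix k n P c s) r) :
    HasPsdFactorization (patternMatrix n fun y => c - I.val y) r := by
  obtain ⟨A, B, hA, hB, hM⟩ := h
  refine ⟨fun S => A ⟨I.plant (S.1.orderEmbOfFin S.2).toEmbedding, hI.plant _⟩, B,
    fun S => hA _, hB, fun S x => ?_⟩
  rw [← hM, patternMatrix_apply]
  simp only [cspMatrix, CSPInstance.plant_val]
  rfl

/-- **The printed route to the SDP lower bounds, modulo Theorem 3.8** (proof of Thm 6.2/6.4):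
under the hypotheses of Thm 3.8 for `f = c − ℑ` (an instance `ℑ` of Max-`𝒫_m` with `opt(ℑ) ≤ s`,
`0 ≤ c − ℑ ≤ 1`, a degree-`d` pseudo-density `D` with `E_x D(x)(c − ℑ(x)) < −ε`, `|D| ≤ K`), for
every `n ≥ 2m` the matrix `M^{n,Π}_{c,s}` has no psd factorisation of size below the Thm 3.8 bound
`(cεn/(d m² K log n))^{d/4} (ε/K)^{3/2} √(E(c − ℑ))` — "by Prop. 6.1 … it is sufficient to lower
bound the psd rank of `M^{n,Π}_{c,s}` … Since `M_n^f` is a submatrix of `M^{n,Π}_{c,s}`, we have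
`rk_psd(M^{n,Π}_{c,s}) ≥ rk_psd(M_n^f)`. By Thm 3.8 …". [cite: LeeRaghavendraSteurer2015, Thm 6.2 proof (p. 25–26)] -/
theorem LeeRaghavendraSteurer2015_thm38.cspMatrix_bound (h38 : LeeRaghavendraSteurer2015_thm38) :
    ∃ c₀ : ℝ, 0 < c₀ ∧
      ∀ (k m d : ℕ) (P : Set ((Fin k → Bool) → Bool)) (c s : ℝ), 1 ≤ m → 1 ≤ d →
      ∀ (I : CSPInstance k m P), I.OptLE s → (∀ y, 0 ≤ c - I.val y ∧ c - I.val y ≤ 1) →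
      ∀ (ε : ℝ), 0 < ε → ε ≤ 1 →
      ∀ (D : (Fin m → Bool) → ℝ) (K : ℝ), IsPseudoDensity d D → (∀ y, |D y| ≤ K) →
        cubeExpect (fun y => D y * (c - I.val y)) < -ε →
      ∀ n : ℕ, 2 * m ≤ n → ∀ r : ℕ,
        (r : ℝ) < (c₀ * ε * n / (d * (m : ℝ) ^ 2 * K * Real.log n)) ^ ((d : ℝ) / 4) *
            (ε / K) ^ ((3 : ℝ) / 2) * Real.sqrt (cubeExpect fun y => c - I.val y) →
        ¬ HasPsdFactorization (cspMatrix k n P c s) r := by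
  obtain ⟨c₀, hc₀, H⟩ := h38
  refine ⟨c₀, hc₀, fun k m d P c s hm hd I hI hf ε hε hε1 D K hD hK hneg n hn r hr hfac => ?_⟩
  exact H m d hm hd (fun y => c - I.val y) hf ε hε hε1 D K hD hK hneg n hn r hr
    (hfac.patternMatrix_of_cspMatrix I hI)

/-! ### Theorem 6.4: the verbatim typing is vacuous — discharge, and the corrected statement (third append) -/

/-- A `0`-ary constraint does not depend on the assignment. [cite: LeeRaghavendraSteurer2015, §1.2 (p. 6)] -/
theorem CSPConstraint.sat_eq_of_arity_zero {n : ℕ} {P : Set ((Fin 0 → Bool) → Bool)}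
    (C : CSPConstraint 0 n P) (x y : Fin n → Bool) : C.sat x = C.sat y :=
  congrArg C.pred (funext fun j => j.elim0)

/-- An instance of a `0`-ary Max-CSP has a constant objective. [cite: LeeRaghavendraSteurer2015, §1.2 (p. 6)] -/
theorem CSPInstance.val_eq_of_arity_zero {n : ℕ} {P : Set ((Fin 0 → Bool) → Bool)}
    (I : CSPInstance 0 n P) (x y : Fin n → Bool) : I.val x = I.val y := by
  simp only [CSPInstance.val, CSPConstraint.sat_eq_of_arity_zero _ x y]

/-- For a `0`-ary Max-CSP every bound above `opt` is certified in every degree: `c' − ℑ` is a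
nonnegative constant, the square of a constant. [cite: LeeRaghavendraSteurer2015, Def. 1.3 (p. 5)] -/
theorem achievesApprox_of_arity_zero {n e : ℕ} (P : Set ((Fin 0 → Bool) → Bool)) {c s : ℝ}
    (hsc : s ≤ c) : AchievesApprox P (degreeLE n e) c s := by
  intro I hI
  refine ⟨1, fun _ _ => Real.sqrt (c - I.val fun _ => false), fun _ => HasDegreeLE.const e _,
    fun x => ?_⟩
  rw [Fin.sum_univ_one, Real.sq_sqrt (sub_nonneg.2 ((hI _).trans hsc)),
    I.val_eq_of_arity_zero x fun _ => false]

/-- **`LeeRaghavendraSteurer2015_thm64` as typed is vacuously true (discharge).**  The named fact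
reproduces the printed hypotheses of Thm 6.4 verbatim — "`d(1) ≥ 2⌈k/2⌉`" together with
"`d(n) ≤ n` for all `n ≥ 1`" — and these are jointly INCONSISTENT for every arity `k ≥ 1`
(`2 ≤ 2⌈k/2⌉ ≤ d(1) ≤ 1`), while for `k = 0` the remaining hypothesis "the degree-`d(n)` sos
relaxation cannot achieve a `(c + ε, s)`-approximation" is unsatisfiable
(`achievesApprox_of_arity_zero`).  So the typed statement carries no content and is proved here by
that case split; it must NOT be cited as the Lee–Raghavendra–Steurer theorem.  The contentful
statement — the printed one with the two conditions read pointwise at the `n` in question, which is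
how the proof (p. 26) uses them — is `LeeRaghavendraSteurer2015_thm64_repaired` below (NOT proved).
[cite: LeeRaghavendraSteurer2015, Thm 6.4 (p. 25–26)] -/
theorem LeeRaghavendraSteurer2015_thm64_holds : LeeRaghavendraSteurer2015_thm64 := by
  intro k P d _ hd1 hdn _ ε s c hε _ hsc _
  refine ⟨1, one_pos, fun n _ hfail _ _ _ _ => ?_⟩
  exfalso
  rcases Nat.eq_zero_or_pos k with hk | hk
  · subst hk
    exact hfail (achievesApprox_of_arity_zero P (by linarith))
  · have h1 := hdn 1 le_rfl
    have h2 : 1 ≤ (k + 1) / 2 := by omega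
    omega

/-- **Lee–Raghavendra–Steurer 2015, Theorem 6.4 — corrected statement (RECORDED REPAIR).**  As
printed (p. 25): "Fix a `k`-ary CSP Max-Π and a monotone increasing function `d : ℕ → ℕ` such that
… `d(1) ≥ 2⌈k/2⌉`, and `d(n) ≤ n` for all `n ≥ 1`, and `lim_{n→∞} d(n) = ∞`. Fix `ε > 0` and
`0 < s < c ≤ 1`. There is a constant `K > 0` such that the following holds. Suppose that for every
`n ≥ 1`, the degree-`d(n)` sos relaxation cannot achieve a `(c + ε, s)`-approximation for Max-Π_n.
Then for all `n ≥ 1`, no SDP relaxation of size at most `K n^{d(n)²/8}` can achieve a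
`(c,s)`-approximation for Max-Π_N for every `N > n^{4d(n)}`."  The first two conditions on `d` are
jointly inconsistent for `k ≥ 1` (`d(1) ≤ 1 < 2 ≤ 2⌈k/2⌉`; see
`LeeRaghavendraSteurer2015_thm64_holds`, which discharges the verbatim typing vacuously).  The
proof (p. 26) uses them only AT the `n` under consideration: `d(n) ≥ 2⌈k/2⌉` (so that `ℑ`, of
degree `k`, pairs with degree-`d(n)` pseudo-densities, §6.1 p. 25 "Fix `d ≥ 2⌈k/2⌉`") and
`d(n) ≤ n` (for `‖D‖_∞ ≤ Σ_{i ≤ d(n)} C(n,i) ≤ 1 + n^{d(n)}`, Fact 6.3).  This def is the printed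
statement with exactly these two conditions moved inside as pointwise guards (and, as in
`LeeRaghavendraSteurer2015_thm64`, the failure hypothesis used at the same `n`, psd-rank currency of
Prop. 6.1); `K` depends on `Π, d(·), ε, s, c` only.  NOT proved here (proof: the §2 duality
`exists_pseudoDensity_of_not_achievesApprox` [PROVED, `SosPseudoDensityDuality.lean`] + Fact 6.3 +
Thm 3.8 `LeeRaghavendraSteurer2015_thm38.cspMatrix_bound`, p. 26).
[cite: LeeRaghavendraSteurer2015, Thm 6.4 (p. 25–26)] -/
def LeeRaghavendraSteurer2015_thm64_repaired : Prop :=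
  ∀ (k : ℕ) (P : Set ((Fin k → Bool) → Bool)) (d : ℕ → ℕ), Monotone d →
    Filter.Tendsto d Filter.atTop Filter.atTop →
    ∀ (ε s c : ℝ), 0 < ε → 0 < s → s < c → c ≤ 1 →
    ∃ K : ℝ, 0 < K ∧ ∀ n : ℕ, 1 ≤ n → 2 * ((k + 1) / 2) ≤ d n → d n ≤ n →
      ¬ AchievesApprox P (degreeLE n (d n / 2)) (c + ε) s →
      ∀ N : ℕ, (n : ℝ) ^ (4 * d n) < N →
      ∀ r : ℕ, (r : ℝ) ≤ K * (n : ℝ) ^ ((d n : ℝ) ^ 2 / 8) →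
        ¬ HasPsdFactorization (cspMatrix k N P c s) r

end Literature.Combinatorics.Optimization

end
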